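import Summits.ValiantsHypothesis.ValiantsHypothesis.Theorems.KPlusLogSqLawTropicalBBlockTriangular
import Summits.ValiantsHypothesis.ValiantsHypothesis.Theorems.KPlusLogSqLawTropicalBRelabel

/-!
# Route `KPlusLogSqLaw`, crux `TropicalB` — Hessenberg designs under the column split: STATES, RESTRICTIONS, the C = 10 bound

HONEST FRAMING.  Helper file toward the registered stubs `stub_tropThin` / `stub_tropFat` of
`Cruxes/TropicalB/Lines/birth.lean` (crux `Summit.ValiantsHypothesis.ValiantsHypothesis.Theses.KPlusLogSqLaw.TropicalB`,
ledger item `stmt-ValiantsHypothesis-19771`, route `KPlusLogSqLaw`, DRAFT; cell `pub-symmetroid`, seat `val-sym-trop-p1`,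
2026-08-26).  It proves the statement of `TropicalB` RESTRICTED TO HESSENBERG SUPPORT with an absolute constant; it does
NOT prove either stub (which quantify over all designs) and asserts nothing about `TropicalB` in general, `KPlusLogSqLaw`,
`MatrixDescartes` or `VP ≠ VNP`.

A design is HESSENBERG (`IsHessenberg ε`, companion definitions file) when the entry in row `a`, column `b` can be present
only for `a ≤ b + 1`.  Its present Leibniz permutations are the interval partitions of `[0, m)`, i.e. the `0 → m` paths of
the transitive DAG on `{0, …, m}`: this is exactly the class of `K`-slope-class PARAMETRIC SHORTEST PATH instances on DAGs
(Carstensen 1983; Gusfield 1980), and it contains the tree's staircase / Carstensen–Mulmuley–Shah families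
(`Literature/Combinatorics/Optimization/ParametricShortestPath.lean`, whose «What is NOT here» lists Gusfield's upper bound).

PRIORITY / DE-DUP (lead ruling R1335, 2026-08-26): the HEADLINE sector theorem «`TropicalB` holds on Hessenberg designs»
(`∃ C`, crux verbatim + `IsHessenberg ε`) is val-sym-trop-p5's (`tropicalB_hessenberg`, `designRowD_hessenberg`, C = 30, via
restricted-optimum sub-additivity over column intervals, files …TropicalBIntervalOpt / …TropicalBHessenberg) — the FIRST proof of
record.  This file is the second seat's DISTINCT content only: the state-split route through `designRowD_split` (companion file
…TropicalBSplit), which gives the sharper constant C = 10, and the relabeled form.  [folklore: D. Gusfield, *Sensitivity analysis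
for combinatorial optimization*, PhD thesis, UC Berkeley 1980; Gusfield 1983 J. ACM 30, 551–563 — `n^{O(log n)}` breakpoints for
parametric shortest paths; Gajjar–Radhakrishnan 2019 Prop. 7 / Thm 45 for the printed recursion.]

* `hessenberg_state_mem`, `card_hessStates_le` — for a present Hessenberg term the rows of the first column block `[0, c)` lie
  in `[0, c]`: at most `c + 1` states;
* `isHessenberg_restrict_left/right` — both restricted designs at a Hessenberg state are Hessenberg (an increasing enumeration
  `r` of a `c`-subset of `[0, c]` has `i ≤ r i`; one of its complement has `c + i ≤ r i` for `i ≥ 1`);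
* `designRowD_hessenberg_pow` — `m ≤ 2^t` ⇒ unsigned row bound `(K + 1)·2^(t(t+3)) − 1` (induction on `t` via `designRowD_split`);
  `designRowD_hessenberg_split` — the explicit form `(K + 1)·2^((log₂ m + 1)(log₂ m + 4)) − 1`;
* `designRowD_hessenberg_ten` — inside the `K + log² m` budget with **C = 10**: `DesignRowD d v ε (2^(10·(K + (log₂ m)²)))`;
* `kPlusLogSq_of_relabel_hessenberg` — the same signed bound for every design that is Hessenberg AFTER a row/column relabeling
  (dominant chains are relabeling-invariant, companion file …TropicalBRelabel);
* `isHessenberg_iff_vanish` — bridge to the vanishing form `b + 1 < a → ε a b l = 0` (trop-p5's files use `IsHessenberg` itself).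

Proof: the split inequality `designRowD_split` with the column blocks `[0, c) ∪ [c, c+e)`, `c = ⌊m/2⌋`.  For a present
Hessenberg term the rows of the first block lie in `[0, c]`, so at most `c + 1` states occur (`hessenberg_state_mem`,
`card_hessStates_le`), and both restricted designs are again Hessenberg (`isHessenberg_restrict_left/right`: an increasing
enumeration `r` of a `c`-subset of `[0, c]` has `i ≤ r i`, one of its complement has `c + i ≤ r i` for `i ≥ 1`); induction
on `t` with `m ≤ 2^t` gives the bound `(K+1)·2^(t(t+3)) − 1` (`designRowD_hessenberg_pow`).  Since dominant chains are
invariant under relabeling rows and columns (`designRowD_of_relabel`, companion file), the same bound holds for every design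
that is Hessenberg AFTER a relabeling (`kPlusLogSq_of_relabel_hessenberg`) — e.g. a walk matrix `I − A − u vᵀ` with `A`
strictly upper triangular and the back entries `u vᵀ` supported in one column `b₀` (the tree's WalkDet shape, blueprint
`Cruxes/DerivedPencilRolle/Lines/staircase-refutation.md` §1) becomes Hessenberg after moving column `b₀` to the last position.
-/

set_option linter.dupNamespace false
set_option autoImplicit false

namespace Summit.ValiantsHypothesis.ValiantsHypothesis.Theorems.KPlusLogSqLaw

open Summit.ValiantsHypothesis.ValiantsHypothesis.Theorems.MatrixDescartes.Negative
open Summit.ValiantsHypothesis.ValiantsHypothesis.Theorems.LacunarySymmetroidMatrixDescartes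
open Summit.ValiantsHypothesis.ValiantsHypothesis.Theorems.LacunarySymmetroidMatrixDescartes.TropicalCensus
open scoped BigOperators
open Finset

/-! ## 1. Increasing enumerations -/

/-- an increasing enumeration of rows avoiding a `c`-subset `R` of `[0, c]` (inside `Fin (c+e)`): all but at most one
of its values exceed `c`, so `c + i ≤ r i` for `i ≥ 1`. [folklore] -/
theorem add_le_val_of_strictMono_compl {c e : ℕ} (R : Finset (Fin (c + e)))
    (hRS : R ⊆ (univ : Finset (Fin (c + e))).filter (fun x : Fin (c + e) => x.val ≤ c)) (hRc : R.card = c)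
    (r : Fin e → Fin (c + e)) (hr : StrictMono r) (hrR : ∀ i, r i ∉ R) :
    ∀ i : Fin e, 1 ≤ (i : ℕ) → c + (i : ℕ) ≤ (r i : ℕ) := by
  classical
  set S := (univ : Finset (Fin (c + e))).filter (fun x : Fin (c + e) => x.val ≤ c) with hS
  -- `S \ R` has at most one element
  have hScard : S.card ≤ c + 1 := by
    calc S.card ≤ (range (c + 1)).card := by
          refine card_le_card_of_injOn (fun x : Fin (c + e) => x.val) (fun x hx => ?_) (fun x _ y _ h => Fin.ext h)
          have hx' : x.val ≤ c := (mem_filter.mp (mem_coe.mp hx)).2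
          exact mem_coe.mpr (mem_range.mpr (show x.val < c + 1 by omega))
      _ = c + 1 := card_range _
  have hdiff : (S \ R).card ≤ 1 := by rw [card_sdiff_of_subset hRS]; omega
  -- two indices with small values would give two elements of `S \ R`
  have hone : ∀ i i' : Fin e, i ≠ i' → (r i : ℕ) ≤ c → (r i' : ℕ) ≤ c → False := by
    intro i i' hii' hi hi'
    have hmem : ∀ j : Fin e, (r j : ℕ) ≤ c → r j ∈ S \ R := fun j hj =>
      mem_sdiff.mpr ⟨mem_filter.mpr ⟨mem_univ _, hj⟩, hrR j⟩
    have hsub : ({r i, r i'} : Finset (Fin (c + e))) ⊆ S \ R := by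
      intro x hx
      rcases mem_insert.mp hx with rfl | hx
      · exact hmem i hi
      · rw [mem_singleton] at hx; rw [hx]; exact hmem i' hi'
    have hne : r i ≠ r i' := fun h => hii' (hr.injective h)
    have h2 : ({r i, r i'} : Finset (Fin (c + e))).card = 2 := card_pair hne
    have := card_le_card hsub
    omega
  have main : ∀ k : ℕ, ∀ hk : k < e, 1 ≤ k → c + k ≤ (r ⟨k, hk⟩ : ℕ) := by
    intro k
    induction k with
    | zero => intro _ h; exact absurd h (by norm_num)
    | succ k ih =>
      intro hk _
      have hlt : (r ⟨k, by omega⟩ : ℕ) < (r ⟨k + 1, hk⟩ : ℕ) :=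
        Fin.lt_def.mp (hr (Fin.mk_lt_mk.mpr (Nat.lt_succ_self k)))
      rcases Nat.eq_zero_or_pos k with hk0 | hkpos
      · -- `k + 1 = 1`: if `r 1 ≤ c` then `r 0 < r 1 ≤ c` as well
        by_contra hcon
        have h1 : (r ⟨k + 1, hk⟩ : ℕ) ≤ c := by omega
        have h0 : (r ⟨k, by omega⟩ : ℕ) ≤ c := by omega
        exact hone ⟨k, by omega⟩ ⟨k + 1, hk⟩ (fun h => by simp [Fin.ext_iff] at h) h0 h1
      · have := ih (by omega) hkpos
        omega
  intro i hi
  exact main i.val i.isLt hi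

/-! ## 2. Hessenberg designs under the column split -/

section HessSplit

variable {c e K : ℕ}

/-- the states that can occur for a Hessenberg design: `c`-subsets of the rows `[0, c]`. -/
theorem hessenberg_state_mem (ε : Fin (c + e) → Fin (c + e) → Fin K → ℤ) (hε : IsHessenberg ε)
    (q : Equiv.Perm (Fin (c + e)) × (Fin (c + e) → Fin K)) (hq : termSign ε q ≠ 0) :
    ((univ : Finset (Fin c)).image fun j => q.1 (Fin.castAdd e j)) ∈
      ((univ : Finset (Fin (c + e))).filter (fun x : Fin (c + e) => x.val ≤ c)).powersetCard c := by
  classical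
  rw [mem_powersetCard]
  refine ⟨fun x hx => ?_, ?_⟩
  · obtain ⟨j, _, rfl⟩ := mem_image.mp hx
    have hpres := (termSign_ne_zero_iff ε q).mp hq (Fin.castAdd e j)
    have h := hε _ _ _ hpres
    simp only [Fin.val_castAdd] at h
    exact mem_filter.mpr ⟨mem_univ _, by omega⟩
  · have hinj : Function.Injective fun j : Fin c => q.1 (Fin.castAdd e j) :=
      q.1.injective.comp (Fin.castAdd_injective _ _)
    rw [card_image_of_injective _ hinj, card_univ, Fintype.card_fin]

/-- at most `c + 1` states occur for a Hessenberg design. [folklore] -/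
theorem card_hessStates_le :
    (((univ : Finset (Fin (c + e))).filter (fun x : Fin (c + e) => x.val ≤ c)).powersetCard c).card ≤ c + 1 := by
  classical
  set S := (univ : Finset (Fin (c + e))).filter (fun x : Fin (c + e) => x.val ≤ c) with hS
  have hScard : S.card ≤ c + 1 := by
    calc S.card ≤ (range (c + 1)).card := by
          refine card_le_card_of_injOn (fun x : Fin (c + e) => x.val) (fun x hx => ?_) (fun x _ y _ h => Fin.ext h)
          have hx' : x.val ≤ c := (mem_filter.mp (mem_coe.mp hx)).2
          exact mem_coe.mpr (mem_range.mpr (show x.val < c + 1 by omega))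
      _ = c + 1 := card_range _
  rw [card_powersetCard]
  calc S.card.choose c ≤ (c + 1).choose c := Nat.choose_le_choose c hScard
    _ = c + 1 := Nat.choose_succ_self_right c

/-- the first restricted design of a Hessenberg design (rows increasing, first column block) is Hessenberg. [folklore] -/
theorem isHessenberg_restrict_left (ε : Fin (c + e) → Fin (c + e) → Fin K → ℤ) (hε : IsHessenberg ε)
    (r : Fin c ↪o Fin (c + e)) : IsHessenberg (fun i j l => ε (r i) (Fin.castAdd e j) l) := by
  intro i j l h
  have h1 := hε _ _ _ h
  have h2 := val_add_le_of_strictMono r r.strictMono ⟨0, Fin.pos i⟩ i (by rw [Fin.le_def]; exact Nat.zero_le _)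
  simp only [Fin.val_castAdd] at h1
  simp only [Nat.sub_zero] at h2
  omega

/-- the second restricted design of a Hessenberg design at a Hessenberg state (rows outside a `c`-subset of `[0, c]`,
increasing; second column block) is Hessenberg. [folklore] -/
theorem isHessenberg_restrict_right (ε : Fin (c + e) → Fin (c + e) → Fin K → ℤ) (hε : IsHessenberg ε)
    (R : Finset (Fin (c + e))) (hRS : R ⊆ (univ : Finset (Fin (c + e))).filter (fun x : Fin (c + e) => x.val ≤ c))
    (hRc : R.card = c) (r : Fin e ↪o Fin (c + e)) (hrR : ∀ i, r i ∉ R) :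
    IsHessenberg (fun i j l => ε (r i) (Fin.natAdd c j) l) := by
  intro i j l h
  have h1 := hε _ _ _ h
  simp only [Fin.val_natAdd] at h1
  rcases Nat.eq_zero_or_pos (i : ℕ) with hi | hi
  · omega
  · have h2 := add_le_val_of_strictMono_compl R hRS hRc r r.strictMono hrR i hi
    omega

end HessSplit

/-! ## 3. The quasi-polynomial bound -/

/-- **Gusfield's bound, dyadic form.**  Every Hessenberg design of format `m ≤ 2^t` with `K` classes has unsigned row
bound `(K + 1)·2^(t·(t+3)) − 1`. [folklore: Gusfield 1980] -/
theorem designRowD_hessenberg_pow (K t : ℕ) : ∀ m : ℕ, m ≤ 2 ^ t →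
    ∀ (d : Fin K → ℕ) (v ε : Fin m → Fin m → Fin K → ℤ), IsHessenberg ε →
      DesignRowD d v ε ((K + 1) * 2 ^ (t * (t + 3)) - 1) := by
  induction t with
  | zero =>
    intro m hm d v ε _
    have hm1 : m ≤ 1 := by simpa using hm
    rcases Nat.le_one_iff_eq_zero_or_eq_one.mp hm1 with rfl | rfl
    · exact designRowD_mono (Nat.zero_le _) (tropRowD_size_zero K 0 d v ε)
    · refine designRowD_mono ?_ (tropRowD_one K d v ε)
      simp
  | succ t ih =>
    intro m hm d v ε hε
    -- the bound is monotone in `t`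
    have hmonoG : (K + 1) * 2 ^ (t * (t + 3)) - 1 ≤ (K + 1) * 2 ^ ((t + 1) * (t + 1 + 3)) - 1 := by
      have : 2 ^ (t * (t + 3)) ≤ 2 ^ ((t + 1) * (t + 1 + 3)) :=
        Nat.pow_le_pow_right (by norm_num) (by nlinarith)
      have := Nat.mul_le_mul_left (K + 1) this
      omega
    by_cases hsmall : m ≤ 2 ^ t
    · exact designRowD_mono hmonoG (ih m hsmall d v ε hε)
    -- split `m = c + e'` with `c = m / 2 ≤ e' ≤ 2^t`
    obtain ⟨c, e', rfl, hc, he', hce⟩ : ∃ c e', m = c + e' ∧ c ≤ 2 ^ t ∧ e' ≤ 2 ^ t ∧ c ≤ e' := by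
      refine ⟨m / 2, m - m / 2, by omega, ?_, ?_, by omega⟩
      · have : 2 ^ (t + 1) = 2 * 2 ^ t := by ring
        omega
      · have : 2 ^ (t + 1) = 2 * 2 ^ t := by ring
        omega
    classical
    set 𝓡 := ((univ : Finset (Fin (c + e'))).filter (fun x : Fin (c + e') => x.val ≤ c)).powersetCard c with h𝓡def
    have hsplit := designRowD_split d v ε 𝓡 (fun R hR => (mem_powersetCard.mp hR).2)
      (B₁ := (K + 1) * 2 ^ (t * (t + 3)) - 1) (B₂ := (K + 1) * 2 ^ (t * (t + 3)) - 1)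
      (fun R _ r _ => ih c hc d _ _ (isHessenberg_restrict_left ε hε r))
      (fun R hR r hr => ih e' he' d _ _
        (isHessenberg_restrict_right ε hε R (mem_powersetCard.mp hR).1 (mem_powersetCard.mp hR).2 r hr))
      (fun q hq => hessenberg_state_mem ε hε q hq)
    refine designRowD_mono ?_ hsplit
    -- arithmetic: `(c+1)·(2·((K+1)·2^(t(t+3)) − 1) + 1) − 1 ≤ (K+1)·2^((t+1)(t+4)) − 1`
    have hstates : 𝓡.card ≤ c + 1 := card_hessStates_le
    have hc1 : c + 1 ≤ 2 ^ t + 1 := by omega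
    set G := (K + 1) * 2 ^ (t * (t + 3)) with hG
    have hGpos : 1 ≤ G := by
      have : 1 ≤ 2 ^ (t * (t + 3)) := Nat.one_le_two_pow
      simp only [hG]; nlinarith
    have h1 : 𝓡.card * (G - 1 + (G - 1) + 1) ≤ (2 ^ t + 1) * (2 * G) := by
      calc 𝓡.card * (G - 1 + (G - 1) + 1) ≤ (2 ^ t + 1) * (G - 1 + (G - 1) + 1) :=
            Nat.mul_le_mul_right _ (hstates.trans hc1)
        _ ≤ (2 ^ t + 1) * (2 * G) := Nat.mul_le_mul_left _ (by omega)
    have h2 : (2 ^ t + 1) * (2 * G) ≤ (K + 1) * 2 ^ ((t + 1) * (t + 1 + 3)) := by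
      have hp : (2 ^ t + 1) * 2 ≤ 2 ^ (t + 2) := by
        have : 2 ^ (t + 2) = 4 * 2 ^ t := by ring
        have : 1 ≤ 2 ^ t := Nat.one_le_two_pow
        omega
      have hexp : 2 ^ (t + 2) * 2 ^ (t * (t + 3)) ≤ 2 ^ ((t + 1) * (t + 1 + 3)) := by
        rw [← pow_add]
        exact Nat.pow_le_pow_right (by norm_num) (by nlinarith)
      calc (2 ^ t + 1) * (2 * G) = ((2 ^ t + 1) * 2) * ((K + 1) * 2 ^ (t * (t + 3))) := by
            simp only [hG]; ring
        _ ≤ 2 ^ (t + 2) * ((K + 1) * 2 ^ (t * (t + 3))) := Nat.mul_le_mul_right _ hp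
        _ = (K + 1) * (2 ^ (t + 2) * 2 ^ (t * (t + 3))) := by ring
        _ ≤ (K + 1) * 2 ^ ((t + 1) * (t + 1 + 3)) := Nat.mul_le_mul_left _ hexp
    omega

/-- **Gusfield's bound.**  Every Hessenberg design of format `(m, K)` has unsigned row bound
`(K + 1)·2^((log₂ m + 1)·(log₂ m + 4)) − 1`, i.e. `(K+1)·m^{O(log m)}` dominant breakpoints along any chain of terms
dominant at increasing slopes. [folklore: Gusfield 1980] -/
theorem designRowD_hessenberg_split {m K : ℕ} (d : Fin K → ℕ) (v ε : Fin m → Fin m → Fin K → ℤ) (hε : IsHessenberg ε) :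
    DesignRowD d v ε ((K + 1) * 2 ^ ((Nat.log 2 m + 1) * (Nat.log 2 m + 4)) - 1) :=
  designRowD_hessenberg_pow K (Nat.log 2 m + 1) m (Nat.lt_pow_succ_log_self (by norm_num) m).le d v ε hε

/-- arithmetic: for `L ≥ 1` the Gusfield bound sits inside the `K + log² m` budget with `C = 10`. [folklore] -/
theorem hessBound_le_kPlusLogSq (K L : ℕ) (hL : 1 ≤ L) :
    (K + 1) * 2 ^ ((L + 1) * (L + 4)) - 1 ≤ 2 ^ (10 * (K + L ^ 2)) := by
  have hK : K + 1 ≤ 2 ^ K := Nat.lt_two_pow_self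
  calc (K + 1) * 2 ^ ((L + 1) * (L + 4)) - 1 ≤ (K + 1) * 2 ^ ((L + 1) * (L + 4)) := Nat.sub_le _ _
    _ ≤ 2 ^ K * 2 ^ ((L + 1) * (L + 4)) := Nat.mul_le_mul_right _ hK
    _ = 2 ^ (K + (L + 1) * (L + 4)) := by rw [← pow_add]
    _ ≤ 2 ^ (10 * (K + L ^ 2)) := Nat.pow_le_pow_right (by norm_num) (by nlinarith)

/-- **The `K + log² m` budget on the Hessenberg class with `C = 10` (unsigned form).**  Every dominant chain with distinct
consecutive terms of a Hessenberg design of format `(m, K)` has at most `2^(10·(K + (log₂ m)²))` breakpoints.  First proof of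
the sector theorem: val-sym-trop-p5's `tropicalB_hessenberg` (C = 30, interval-optimum sub-additivity); this is the state-split
route with the sharper constant. [folklore: Gusfield 1980, in the dominance vocabulary] -/
theorem designRowD_hessenberg_ten {m K : ℕ} (d : Fin K → ℕ) (v ε : Fin m → Fin m → Fin K → ℤ)
    (hε : IsHessenberg ε) : DesignRowD d v ε (2 ^ (10 * (K + Nat.log 2 m ^ 2))) := by
  rcases Nat.lt_or_ge m 2 with hm | hm
  · -- `m ≤ 1`: at most `K − 1` breakpoints
    have hK : K - 1 ≤ 2 ^ (10 * (K + Nat.log 2 m ^ 2)) := by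
      have : K < 2 ^ K := Nat.lt_two_pow_self
      have : 2 ^ K ≤ 2 ^ (10 * (K + Nat.log 2 m ^ 2)) := Nat.pow_le_pow_right (by norm_num) (by nlinarith)
      omega
    rcases Nat.le_one_iff_eq_zero_or_eq_one.mp (Nat.lt_succ_iff.mp hm) with rfl | rfl
    · exact designRowD_mono (Nat.zero_le _) (tropRowD_size_zero K 0 d v ε)
    · exact designRowD_mono hK (tropRowD_one K d v ε)
  · have hL : 1 ≤ Nat.log 2 m := Nat.log_pos (by norm_num) hm
    exact designRowD_mono (hessBound_le_kPlusLogSq K _ hL) (designRowD_hessenberg_split d v ε hε)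

/-- **Relabeled Hessenberg designs.**  If some relabeling of rows and columns makes the support Hessenberg, every
sign-alternating dominant chain of the design has at most `2^(10·(K + (log₂ m)²))` breakpoints (dominant chains are
invariant under relabeling).  Covers e.g. walk matrices `I − A − u vᵀ` (`A` strictly upper triangular, back entries in one
column), which are Hessenberg after moving that column to the end. [folklore: Gusfield 1980, in the dominance vocabulary] -/
theorem kPlusLogSq_of_relabel_hessenberg {m K : ℕ} (d : Fin K → ℕ) (v ε : Fin m → Fin m → Fin K → ℤ)
    (π ρ : Equiv.Perm (Fin m)) (hε : IsHessenberg (fun a b l => ε (π a) (ρ b) l))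
    {n : ℕ} (θ : Fin (n + 1) → ℤ) (p : Fin (n + 1) → Equiv.Perm (Fin m) × (Fin m → Fin K))
    (hθ : StrictMono θ) (hdom : ∀ k, IsDominant d v ε (θ k) (p k))
    (halt : ∀ k : Fin n, termSign ε (p k.castSucc) * termSign ε (p k.succ) < 0) :
    n ≤ 2 ^ (10 * (K + Nat.log 2 m ^ 2)) :=
  le_of_designRowD (designRowD_of_relabel d v ε π ρ
    (designRowD_hessenberg_ten d (fun a b l => v (π a) (ρ b) l) (fun a b l => ε (π a) (ρ b) l) hε))
    θ p hθ hdom halt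

/-- bridge between the two hypothesis forms of Hessenberg support in the tree: `IsHessenberg ε` (an entry can be present
only if `a ≤ b + 1`) iff every entry with `b + 1 < a` is absent. [folklore] -/
theorem isHessenberg_iff_vanish {m K : ℕ} (ε : Fin m → Fin m → Fin K → ℤ) :
    IsHessenberg ε ↔ ∀ (a b : Fin m) (l : Fin K), (b : ℕ) + 1 < (a : ℕ) → ε a b l = 0 := by
  constructor
  · intro h a b l hab
    by_contra hne
    have := h a b l hne
    omega
  · intro h a b l hne
    by_contra hab
    exact hne (h a b l (by omega))

end Summit.ValiantsHypothesis.ValiantsHypothesis.Theorems.KPlusLogSqLaw
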